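import Literature.MathematicalPhysics.QuantumFieldTheory.Balaban1983to89.B12EuclCov567

/-!
# Bałaban CMP 109 (1987) §5 pp. 292–293, (5.2)–(5.8): the Euclidean covariance of the finite-volume polarization tensor and of its limit
# from invariance of the functional NEAR `B = 0` ONLY — the LOCAL twin of `B12EuclCov567` §3–§5 and `B12Transl58` §2

CITATION HEADER.  Source: T. Bałaban, *Renormalization group approach to lattice gauge field theories. I*, Commun. Math. Phys. **109** (1987)
249–301 [Balaban1987RG1], §5 p. 292 (5.1)–(5.6), p. 293 (5.7)–(5.8); §1 p. 264 (1.20)–(1.21).  Print (p. 292): *«The function 𝐄^{(j)}(U_j(exp iB)) is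
invariant with respect to all Euclidean symmetries r of the lattice T₁^{(j)}, 𝐄^{(j)}(U_j(exp irB)) = 𝐄^{(j)}(rU_j(exp iB)) = 𝐄^{(j)}(U_j(exp iB)), (5.2) …
The invariance (5.2) yields the following covariant transformation law for the polarization tensor: Π(rb, rb′) = Π(b, b′), (5.4)»*.  The functional
`B ↦ 𝐄^{(j)}(U_j(exp iB))` of print is defined (and analytic) on a NEIGHBOURHOOD of `B = 0` ((4.4) p. 281, p. 264 before (1.20)), and (5.2) is an identity
between its values there; the polarization tensor (5.1)∕(1.20) is a second derivative AT `B = 0`.  The sibling modules `B12Transl58.hessian_translate_pi`,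
`B12EuclCov567.hessian_perm_pi ∕ hessian_refl_pi ∕ cov567_finiteVolume(_rsgn) ∕ symmetries_of_limit_of_invariance` ask the functional to be `C²` on the
WHOLE field space and invariant at EVERY `B` — convenient abstractions, stronger than what print has.  THIS MODULE proves the same conclusions from
invariance as GERMS AT `0` (`f ∘ r =ᶠ[𝓝 0] f`), with NO differentiability hypothesis for the covariance laws (5.4)∕(5.6)∕(5.7)∕(5.8)₁ (the three actions (5.3)
are continuous linear EQUIVALENCES of the field space, and the second derivative at `0` of `f ∘ r` is that of `f` composed with `r` unconditionally), and
with `C²` AT `0` only for the Hessian symmetry behind (5.8)₂.  Consumed at the record by the NODE O port (row PT-A-2 S5-A), where invariance near `0` is what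
the inductive construction delivers ([I] p. 263, (2.17) p. 269: the renormalization transformations preserve the symmetries ON THE SMALL-FIELD DOMAINS).

WHAT IS PROVED (kernel-checked, no `sorry`, standard axioms; `[folklore]` calculus + the cited bookkeeping).
* §1 `hessian_comp_equiv_of_eventuallyEq`: `f ∘ g =ᶠ[𝓝 0] f` for a continuous linear equivalence `g` ⇒ `D²f(0)(gv, gw) = D²f(0)(v, w)` (Mathlib
  `ContinuousLinearEquiv.iteratedFDerivWithin_comp_right` + `Filter.EventuallyEq.iteratedFDeriv`; no regularity).
* §2 the actions (5.3) as continuous linear EQUIVALENCES of `Λ → T → V`: `exists_translateCLE`, `exists_permCLE`, `exists_reflCLE` (signs `ε ν` with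
  `ε ν * ε ν = 1`, involutive site maps) — theorem-only twins of `B12Transl58.exists_translateCLM`, `B12EuclCov567.exists_permCLM ∕ exists_reflCLM`.
* §3 finite volume, local hypotheses: `hessian_translate_pi_local`, `hessian_perm_pi_local`, `hessian_refl_pi_local`, `eq121_finiteVolume_local`
  (translation invariance near `0` + `C²` at `0` ⇒ the Hessian kernel is translation invariant, symmetric, a function of `x − y`, `H_{μν}(z,0) = H_{νμ}(−z,0)`),
  `cov567_finiteVolume_rsgn_local`.
* §4 the limit: `symmetries_of_limit_of_local_invariance` — `B12EuclCov567.symmetries_of_limit` fed by §3: per volume a function `f n` invariant NEAR `0`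
  under the translations, direction permutations and reflections and `C²` AT `0`, `Πv n` its Hessian kernel at `0`, intertwining projections
  `π n : Z^d →+ Tn n`, the pointwise limit (5.1) ⇒ (5.8)₁, (5.8)₂, `B12Beta.PermCovariant`, `B12Transverse536.ReflCovariant` for the limit kernel.
NOT PROVED ∕ not claimed: (5.2) itself, (5.9), (5.10), anything about `β`.
-/

noncomputable section

namespace Literature.MathematicalPhysics.QuantumFieldTheory.Balaban1983to89.B12EuclCov567Local

open Filter
open _root_.Topology
open Literature.MathematicalPhysics.QuantumFieldTheory.GawedzkiKupiainen1985.PeriodicGleason (Pt)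
open Literature.MathematicalPhysics.QuantumFieldTheory.Balaban1983to89.B12Covariance54 (permPt twist)
open Literature.MathematicalPhysics.QuantumFieldTheory.Balaban1983to89.B12Transverse536 (rsgn ReflCovariant rsgn_self rsgn_of_ne)
open Literature.MathematicalPhysics.QuantumFieldTheory.Balaban1983to89.B12Transl58 (apply_eq_apply_sub_zero swap_kernel hessian_swap)
open Literature.MathematicalPhysics.QuantumFieldTheory.Balaban1983to89.B12EuclCov567 (symmetries_of_limit)

/-! ## §1 The second derivative at `0` of a germ invariant under a continuous linear equivalence -/

section Abstract

variable {𝕜 : Type*} [NontriviallyNormedField 𝕜] {E F : Type*} [NormedAddCommGroup E] [NormedSpace 𝕜 E]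
  [NormedAddCommGroup F] [NormedSpace 𝕜 F]

/-- **`f ∘ g = f` NEAR `0` ⇒ `D²f(0)(gv, gw) = D²f(0)(v, w)`** for a continuous linear equivalence `g`, with no differentiability hypothesis (if `f` is
not twice differentiable at `0` both sides are the same junk: the iterated derivative of `f ∘ g` is that of `f` composed with `g`, Mathlib
`ContinuousLinearEquiv.iteratedFDerivWithin_comp_right`).  The abstract content of (5.2) ⇒ (5.4) for functionals defined near `B = 0`. [cite: Balaban1987RG1, (5.2)-(5.4) p.292] -/
theorem hessian_comp_equiv_of_eventuallyEq (g : E ≃L[𝕜] E) {f : E → F} (hinv : ∀ᶠ x in 𝓝 (0 : E), f (g x) = f x) (v w : E) :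
    fderiv 𝕜 (fderiv 𝕜 f) 0 (g v) (g w) = fderiv 𝕜 (fderiv 𝕜 f) 0 v w := by
  have hinv₁ : (f ∘ g) =ᶠ[𝓝 0] f := hinv
  have h1 : iteratedFDeriv 𝕜 2 (f ∘ g) 0 = iteratedFDeriv 𝕜 2 f 0 := (hinv₁.iteratedFDeriv 𝕜 2).eq_of_nhds
  have h2 : iteratedFDeriv 𝕜 2 (f ∘ g) 0 = (iteratedFDeriv 𝕜 2 f (g 0)).compContinuousLinearMap fun _ => (g : E →L[𝕜] E) := by
    have h := g.iteratedFDerivWithin_comp_right f uniqueDiffOn_univ (Set.mem_univ (g 0)) 2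
    rwa [Set.preimage_univ, iteratedFDerivWithin_univ, iteratedFDerivWithin_univ] at h
  have h3 := congrArg (fun Φ : ContinuousMultilinearMap 𝕜 (fun _ : Fin 2 => E) F => Φ ![v, w]) (h2.symm.trans h1)
  simp only [ContinuousMultilinearMap.compContinuousLinearMap_apply, map_zero, iteratedFDeriv_two_apply] at h3
  simpa using h3

end Abstract

/-! ## §2 The actions (5.3) as continuous linear EQUIVALENCES of the finite-volume field space `Λ → T → V` -/

section Actions

variable (𝕜 : Type*) [NontriviallyNormedField 𝕜] {Λ T V : Type*} [NormedAddCommGroup V] [NormedSpace 𝕜 V]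

/-- **(5.3) for a translation `τ_a` is a continuous linear equivalence** of the field space: `(τ_a B)_μ(y) = B_μ(y − a)` (inverse `τ_{−a}`; the `CLM` version is
`B12Transl58.exists_translateCLM`). [cite: Balaban1987RG1, (5.3) p.292] -/
theorem exists_translateCLE [AddCommGroup T] (a : T) :
    ∃ τ : (Λ → T → V) ≃L[𝕜] (Λ → T → V), ∀ B μ y, τ B μ y = B μ (y - a) :=
  ⟨{ toFun := fun B μ y => B μ (y - a)
     invFun := fun B μ y => B μ (y + a)
     map_add' := fun _ _ => rfl
     map_smul' := fun _ _ => rfl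
     left_inv := fun B => by funext μ y; simp
     right_inv := fun B => by funext μ y; simp
     continuous_toFun := continuous_pi fun μ => continuous_pi fun y => (continuous_apply (y - a)).comp (continuous_apply μ)
     continuous_invFun := continuous_pi fun μ => continuous_pi fun y => (continuous_apply (y + a)).comp (continuous_apply μ) },
    fun _ _ _ => rfl⟩

/-- **(5.3) for an axis permutation `r_π` is a continuous linear equivalence**: `(r_πB)_ν(y) = B_{σ⁻¹ν}(r⁻¹y)` (the `CLM` version is
`B12EuclCov567.exists_permCLM`). [cite: Balaban1987RG1, (5.3) p.292 with (5.6)] -/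
theorem exists_permCLE (σ : Equiv.Perm Λ) (r : T ≃ T) :
    ∃ τ : (Λ → T → V) ≃L[𝕜] (Λ → T → V), ∀ B ν y, τ B ν y = B (σ.symm ν) (r.symm y) :=
  ⟨{ toFun := fun B ν y => B (σ.symm ν) (r.symm y)
     invFun := fun B ν y => B (σ ν) (r y)
     map_add' := fun _ _ => rfl
     map_smul' := fun _ _ => rfl
     left_inv := fun B => by funext ν y; simp
     right_inv := fun B => by funext ν y; simp
     continuous_toFun := continuous_pi fun ν => continuous_pi fun y => (continuous_apply (r.symm y)).comp (continuous_apply (σ.symm ν))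
     continuous_invFun := continuous_pi fun ν => continuous_pi fun y => (continuous_apply (r y)).comp (continuous_apply (σ ν)) },
    fun _ _ _ => rfl⟩

/-- **(5.3) for a reflection is a continuous linear equivalence**: `(εB)_ν(y) = ε_ν B_ν(t_ν y)` for signs `ε_ν` with `ε_ν ε_ν = 1` and involutive site maps `t_ν`
(the bond-reversal signs and shifted reflections FORCED by (5.3), `B12Covariance54.pull_reflPt`; the `CLM` version is `B12EuclCov567.exists_reflCLM`).
[cite: Balaban1987RG1, (5.3) p.292 with (5.7) p.293] -/
theorem exists_reflCLE (ε : Λ → 𝕜) (hε : ∀ ν, ε ν * ε ν = 1) (t : Λ → T ≃ T) (ht : ∀ ν y, t ν (t ν y) = y) :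
    ∃ τ : (Λ → T → V) ≃L[𝕜] (Λ → T → V), ∀ B ν y, τ B ν y = ε ν • B ν (t ν y) :=
  ⟨{ toFun := fun B ν y => ε ν • B ν (t ν y)
     invFun := fun B ν y => ε ν • B ν (t ν y)
     map_add' := fun B B' => by funext ν y; simp [smul_add]
     map_smul' := fun c B => by funext ν y; simp [smul_comm c (ε ν)]
     left_inv := fun B => by funext ν y; simp [ht, smul_smul, hε]
     right_inv := fun B => by funext ν y; simp [ht, smul_smul, hε]
     continuous_toFun := continuous_pi fun ν => continuous_pi fun y =>
       continuous_const.smul (((continuous_apply (t ν y)).comp (continuous_apply (A := fun _ : Λ => T → V) ν)))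
     continuous_invFun := continuous_pi fun ν => continuous_pi fun y =>
       continuous_const.smul (((continuous_apply (t ν y)).comp (continuous_apply (A := fun _ : Λ => T → V) ν))) },
    fun _ _ _ => rfl⟩

end Actions

/-! ## §3 Finite volume: (5.2) NEAR `B = 0` ⇒ (5.4) ⇒ (5.6), (5.7), (1.21)₁∕(5.8) for the Hessian kernel on the torus -/

section Hessian

variable {𝕜 : Type*} [NontriviallyNormedField 𝕜] {F : Type*} [NormedAddCommGroup F] [NormedSpace 𝕜 F]
  {Λ T V : Type*} [NormedAddCommGroup V] [NormedSpace 𝕜 V] [Fintype Λ] [Fintype T] [DecidableEq Λ] [DecidableEq T]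

/-- **(5.2) near `0` ⇒ (5.4) for the translations**: `f(τ_a B) = f(B)` for `B` near `0` (all `a`) ⇒ the Hessian kernel at `0` is invariant under
`(x, y) ↦ (x + a, y + a)` — LOCAL twin of `B12Transl58.hessian_translate_pi`, no `C²` hypothesis. [cite: Balaban1987RG1, (5.2)-(5.4) p.292; (1.21) p.264] -/
theorem hessian_translate_pi_local [AddCommGroup T] {f : (Λ → T → V) → F}
    (hinv : ∀ a : T, (fun B : Λ → T → V => f (fun μ y => B μ (y - a))) =ᶠ[𝓝 0] f) (μ ν : Λ) (a x y : T) (v w : V) :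
    fderiv 𝕜 (fderiv 𝕜 f) 0 (Pi.single μ (Pi.single (x + a) v)) (Pi.single ν (Pi.single (y + a) w)) =
      fderiv 𝕜 (fderiv 𝕜 f) 0 (Pi.single μ (Pi.single x v)) (Pi.single ν (Pi.single y w)) := by
  obtain ⟨τ, hτ⟩ := exists_translateCLE (𝕜 := 𝕜) (Λ := Λ) (V := V) a
  have hτ' : ∀ B, τ B = fun μ y => B μ (y - a) := fun B => funext fun μ => funext fun y => hτ B μ y
  have hinv' : ∀ᶠ B in 𝓝 (0 : Λ → T → V), f (τ B) = f B := (hinv a).mono fun B hB => by rw [hτ' B]; exact hB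
  have hs : ∀ (κ : Λ) (z : T) (u : V), τ (Pi.single κ (Pi.single z u)) = Pi.single κ (Pi.single (z + a) u) := by
    intro κ z u
    rw [hτ']
    funext κ' y'
    by_cases hκ : κ' = κ
    · subst hκ
      simp [Pi.single_apply, sub_eq_iff_eq_add]
    · simp [hκ]
  rw [← hs μ x v, ← hs ν y w]
  exact hessian_comp_equiv_of_eventuallyEq τ hinv' (Pi.single μ (Pi.single x v) : Λ → T → V) (Pi.single ν (Pi.single y w) : Λ → T → V)

/-- **(5.2) near `0` ⇒ (5.4) ⇒ (5.6) for an axis permutation** — LOCAL twin of `B12EuclCov567.hessian_perm_pi`. [cite: Balaban1987RG1, (5.2)-(5.6) p.292] -/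
theorem hessian_perm_pi_local {f : (Λ → T → V) → F} (σ : Equiv.Perm Λ) (r : T ≃ T)
    (hinv : (fun B : Λ → T → V => f (fun ν y => B (σ.symm ν) (r.symm y))) =ᶠ[𝓝 0] f) (μ ν : Λ) (x y : T) (v w : V) :
    fderiv 𝕜 (fderiv 𝕜 f) 0 (Pi.single (σ μ) (Pi.single (r x) v)) (Pi.single (σ ν) (Pi.single (r y) w)) =
      fderiv 𝕜 (fderiv 𝕜 f) 0 (Pi.single μ (Pi.single x v)) (Pi.single ν (Pi.single y w)) := by
  obtain ⟨τ, hτ⟩ := exists_permCLE (𝕜 := 𝕜) (V := V) σ r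
  have hτ' : ∀ B, τ B = fun ν y => B (σ.symm ν) (r.symm y) := fun B => funext fun ν => funext fun y => hτ B ν y
  have hinv' : ∀ᶠ B in 𝓝 (0 : Λ → T → V), f (τ B) = f B := hinv.mono fun B hB => by rw [hτ' B]; exact hB
  have hs : ∀ (κ : Λ) (z : T) (u : V), τ (Pi.single κ (Pi.single z u)) = Pi.single (σ κ) (Pi.single (r z) u) := by
    intro κ z u
    rw [hτ']
    funext κ' y'
    by_cases hκ : κ' = σ κ
    · subst hκ
      simp [Pi.single_apply, Equiv.symm_apply_eq]
    · have hκ' : σ.symm κ' ≠ κ := fun h => hκ (σ.symm_apply_eq.1 h)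
      simp [hκ, hκ']
  rw [← hs μ x v, ← hs ν y w]
  exact hessian_comp_equiv_of_eventuallyEq τ hinv' (Pi.single μ (Pi.single x v) : Λ → T → V) (Pi.single ν (Pi.single y w) : Λ → T → V)

/-- **(5.2) near `0` ⇒ (5.4) ⇒ (5.7) for a reflection** (signs `ε_ν = ±1`, involutive site maps `t_ν`) — LOCAL twin of `B12EuclCov567.hessian_refl_pi`.
[cite: Balaban1987RG1, (5.2)-(5.4) p.292, (5.7) p.293] -/
theorem hessian_refl_pi_local {f : (Λ → T → V) → F} (ε : Λ → 𝕜) (hε : ∀ ν, ε ν * ε ν = 1) (t : Λ → T ≃ T)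
    (ht : ∀ ν y, t ν (t ν y) = y) (hinv : (fun B : Λ → T → V => f (fun ν y => ε ν • B ν (t ν y))) =ᶠ[𝓝 0] f) (μ ν : Λ) (x y : T) (v w : V) :
    fderiv 𝕜 (fderiv 𝕜 f) 0 (Pi.single μ (Pi.single (t μ x) v)) (Pi.single ν (Pi.single (t ν y) w)) =
      (ε μ * ε ν) • fderiv 𝕜 (fderiv 𝕜 f) 0 (Pi.single μ (Pi.single x v)) (Pi.single ν (Pi.single y w)) := by
  obtain ⟨τ, hτ⟩ := exists_reflCLE (𝕜 := 𝕜) (V := V) ε hε t ht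
  have hτ' : ∀ B, τ B = fun ν y => ε ν • B ν (t ν y) := fun B => funext fun ν => funext fun y => hτ B ν y
  have hinv' : ∀ᶠ B in 𝓝 (0 : Λ → T → V), f (τ B) = f B := hinv.mono fun B hB => by rw [hτ' B]; exact hB
  have hs : ∀ (κ : Λ) (z : T) (u : V), τ (Pi.single κ (Pi.single (t κ z) u)) = ε κ • Pi.single κ (Pi.single z u) := by
    intro κ z u
    rw [hτ']
    funext κ' y'
    by_cases hκ : κ' = κ
    · subst hκ
      have hinj : ∀ y, t κ' y = t κ' z ↔ y = z := fun y => ⟨fun h => by simpa [ht] using congrArg (t κ') h, fun h => by rw [h]⟩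
      simp [Pi.single_apply, hinj]
    · simp [hκ]
  have h := hessian_comp_equiv_of_eventuallyEq τ hinv' (Pi.single μ (Pi.single (t μ x) v) : Λ → T → V)
    (Pi.single ν (Pi.single (t ν y) w) : Λ → T → V)
  simp only [hs, map_smul, smul_apply, smul_smul, mul_comm (ε ν)] at h
  exact h.symm

/-- **(1.21)₁ and (5.8)₂ AT FINITE VOLUME from translation invariance NEAR `0` and `C²` AT `0`** (`𝕜 = ℝ` or `ℂ`): the Hessian kernel
`H_{μν}(x, y) = δ²f∕δB_μ(x)δB_ν(y)|₀` (charge direction `v` twice) is translation invariant, symmetric, a function of `x − y`, and `H_{μν}(z, 0) = H_{νμ}(−z, 0)` —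
LOCAL twin of `B12Transl58.eq121_finiteVolume`. [cite: Balaban1987RG1, (1.20)-(1.21) p.264; (5.8) p.293] -/
theorem eq121_finiteVolume_local [IsRCLikeNormedField 𝕜] [AddCommGroup T] {f : (Λ → T → V) → F} (hf : ContDiffAt 𝕜 2 f 0)
    (hinv : ∀ a : T, (fun B : Λ → T → V => f (fun μ y => B μ (y - a))) =ᶠ[𝓝 0] f) (v : V) {H : Λ → Λ → T → T → F}
    (hH : ∀ μ ν x y, H μ ν x y = fderiv 𝕜 (fderiv 𝕜 f) 0 (Pi.single μ (Pi.single x v)) (Pi.single ν (Pi.single y v))) :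
    (∀ μ ν a x y, H μ ν (x + a) (y + a) = H μ ν x y) ∧ (∀ μ ν x y, H μ ν x y = H ν μ y x) ∧
      (∀ μ ν x y, H μ ν x y = H μ ν (x - y) 0) ∧ ∀ μ ν z, H μ ν z 0 = H ν μ (-z) 0 := by
  have hT : ∀ μ ν a x y, H μ ν (x + a) (y + a) = H μ ν x y := fun μ ν a x y => by
    rw [hH, hH]; exact hessian_translate_pi_local hinv μ ν a x y v v
  have hS : ∀ μ ν x y, H μ ν x y = H ν μ y x := fun μ ν x y => by
    rw [hH, hH]; exact hessian_swap hf _ _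
  exact ⟨hT, hS, fun μ ν => apply_eq_apply_sub_zero (hT μ ν), swap_kernel hT hS⟩

end Hessian

section Real

variable {T V : Type*} [NormedAddCommGroup V] [NormedSpace ℝ V] [Fintype T] [DecidableEq T] {d : ℕ}

/-- **Finite volume, real field space with print's signs, LOCAL hypotheses**: invariance of `f` NEAR `0` under the actions (5.3) of all direction permutations
(site maps `r σ`) and of the single-axis reflections (signs `rsgn ρ`, involutive site maps `t ρ ν`) ⇒ `H_{σμ,σν}(r_σx, r_σy) = H_{μν}(x, y)` and
`H_{μν}(t_{ρ;μ}x, t_{ρ;ν}y) = ε_με_ν H_{μν}(x, y)` for the Hessian kernel `H` at `0` — LOCAL twin of `B12EuclCov567.cov567_finiteVolume_rsgn`, no `C²` hypothesis.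
[cite: Balaban1987RG1, (5.2)-(5.6) p.292, (5.7) p.293; (1.20)-(1.21) p.264] -/
theorem cov567_finiteVolume_rsgn_local {f : (Fin d → T → V) → ℝ} (v : V) (r : Equiv.Perm (Fin d) → T ≃ T)
    (hfperm : ∀ σ : Equiv.Perm (Fin d), (fun B : Fin d → T → V => f (fun ν y => B (σ.symm ν) ((r σ).symm y))) =ᶠ[𝓝 0] f)
    (t : Fin d → Fin d → T ≃ T) (ht : ∀ ρ ν y, t ρ ν (t ρ ν y) = y)
    (hfrefl : ∀ ρ, (fun B : Fin d → T → V => f (fun ν y => rsgn ρ ν • B ν (t ρ ν y))) =ᶠ[𝓝 0] f)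
    {H : Fin d → Fin d → T → T → ℝ}
    (hH : ∀ μ ν x y, H μ ν x y = fderiv ℝ (fderiv ℝ f) 0 (Pi.single μ (Pi.single x v)) (Pi.single ν (Pi.single y v))) :
    (∀ (σ : Equiv.Perm (Fin d)) μ ν x y, H (σ μ) (σ ν) (r σ x) (r σ y) = H μ ν x y) ∧
      ∀ ρ μ ν x y, H μ ν (t ρ μ x) (t ρ ν y) = rsgn ρ μ * rsgn ρ ν * H μ ν x y := by
  have hε : ∀ ρ ν : Fin d, rsgn ρ ν * rsgn ρ ν = 1 := fun ρ ν => by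
    by_cases h : ν = ρ
    · rw [h, rsgn_self]; norm_num
    · rw [rsgn_of_ne h]; norm_num
  refine ⟨fun σ μ ν x y => ?_, fun ρ μ ν x y => ?_⟩
  · rw [hH, hH]; exact hessian_perm_pi_local σ (r σ) (hfperm σ) μ ν x y v v
  · rw [hH, hH, hessian_refl_pi_local (rsgn ρ) (hε ρ) (t ρ) (ht ρ) (hfrefl ρ) μ ν x y v v, smul_eq_mul]

end Real

/-! ## §4 The limit (5.1): all of (5.6)–(5.8) for the limit tensor from LOCAL invariance at finite volume -/

section Limit

variable {d : ℕ} {V : Type*} [NormedAddCommGroup V] [NormedSpace ℝ V] {P : Fin d → Fin d → Pt d → Pt d → ℝ}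
  {ι : Type*} {l : Filter ι} [l.NeBot] {Tn : ι → Type*} [∀ n, AddCommGroup (Tn n)] [∀ n, Fintype (Tn n)] [∀ n, DecidableEq (Tn n)]

/-- **ALL OF (5.6)–(5.8) FOR THE LIMIT TENSOR FROM (5.2) NEAR `B = 0`**: per volume a function `f n` of the bond field, `C²` AT `0` and invariant NEAR `0`
under the translations, the direction permutations and the reflections (actions (5.3)), `Πv n` its Hessian kernel at `0`, intertwining projections
`π n : Z^d →+ Tn n` and the pointwise limit (5.1) ⇒ on `Z^d`: (5.8)₁ `Π_{μν}(x, y) = K_{μν}(x − y)` (`K = Π(·, 0)`), (5.8)₂ `K_{μν}(z) = K_{νμ}(−z)`,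
(5.6) `B12Beta.PermCovariant K`, (5.7) `ReflCovariant K` — `B12EuclCov567.symmetries_of_limit` with its finite-volume rows supplied by §3.
[cite: Balaban1987RG1, (5.1)-(5.6) p.292, (5.7)-(5.8) p.293; (1.20)-(1.21) p.264] -/
theorem symmetries_of_limit_of_local_invariance (π : ∀ n, Pt d →+ Tn n) {f : ∀ n, (Fin d → Tn n → V) → ℝ}
    (hf : ∀ n, ContDiffAt ℝ 2 (f n) 0) (v : V) {Pv : ∀ n, Fin d → Fin d → Tn n → Tn n → ℝ}
    (hH : ∀ n μ ν x y, Pv n μ ν x y = fderiv ℝ (fderiv ℝ (f n)) 0 (Pi.single μ (Pi.single x v)) (Pi.single ν (Pi.single y v)))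
    (hlim : ∀ μ ν x y, Tendsto (fun n => Pv n μ ν (π n x) (π n y)) l (𝓝 (P μ ν x y)))
    (hftransl : ∀ n (a : Tn n), (fun B : Fin d → Tn n → V => f n (fun μ y => B μ (y - a))) =ᶠ[𝓝 0] f n)
    (rn : ∀ n, Equiv.Perm (Fin d) → Tn n ≃ Tn n) (hπr : ∀ n σ x, π n (permPt σ x) = rn n σ (π n x))
    (hfperm : ∀ n (σ : Equiv.Perm (Fin d)), (fun B : Fin d → Tn n → V => f n (fun ν y => B (σ.symm ν) ((rn n σ).symm y))) =ᶠ[𝓝 0] f n)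
    (tn : ∀ n, Fin d → Fin d → Tn n ≃ Tn n) (htn : ∀ n ρ ν y, tn n ρ ν (tn n ρ ν y) = y)
    (hπt : ∀ n ρ ν x, π n (twist ρ ν x) = tn n ρ ν (π n x))
    (hfrefl : ∀ n ρ, (fun B : Fin d → Tn n → V => f n (fun ν y => rsgn ρ ν • B ν (tn n ρ ν y))) =ᶠ[𝓝 0] f n) :
    (∀ μ ν x y, P μ ν x y = P μ ν (x - y) 0) ∧ (∀ μ ν z, P μ ν z 0 = P ν μ (-z) 0) ∧
      B12Beta.PermCovariant (fun μ ν z => P μ ν z 0) ∧ ReflCovariant (fun μ ν z => P μ ν z 0) :=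
  symmetries_of_limit π (fun n => (eq121_finiteVolume_local (hf n) (hftransl n) v (hH n)).1)
    (fun n => (eq121_finiteVolume_local (hf n) (hftransl n) v (hH n)).2.1) hlim (fun n σ => rn n σ) hπr
    (fun n => (cov567_finiteVolume_rsgn_local v (rn n) (hfperm n) (tn n) (htn n) (hfrefl n) (hH n)).1)
    (fun n ρ ν => tn n ρ ν) hπt
    (fun n => (cov567_finiteVolume_rsgn_local v (rn n) (hfperm n) (tn n) (htn n) (hfrefl n) (hH n)).2)

end Limit

end Literature.MathematicalPhysics.QuantumFieldTheory.Balaban1983to89.B12EuclCov567Local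

end
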